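import Mathlib.NumberTheory.Cyclotomic.Basic
import Mathlib.NumberTheory.NumberField.Cyclotomic.Basic
import Mathlib.LinearAlgebra.Quotient.Basic
import Mathlib.Order.Filter.AtTopBot.Basic
import Literature.Computability.Cryptography.RingLWE
import Literature.Algebra.EuclideanLattices.Problems
import Literature.Algebra.EuclideanLattices.Encoding
import Literature.Computability.Complexity.Randomized
import Literature.Computability.Cryptography.LWEHardness
import HarnessLib

-- provenance: harness21/H21/H21/Statements/PQC/RingLWE.lean @ c144f38 (interim HEAD d8f2665); M5 mechanical rewrite
/-!
# Ring-LWE / Module-LWE pseudorandomness and Ideal-SVP (family `pqc`, statement **pqc.S29**)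

Namespace `Literature.PQC`.  This file records, as *definitions of statements* (`def … : Prop`, flag
role), the decision Ring-LWE and Module-LWE assumptions over the ring of integers of a family of
number fields, the quantum worst-case hardness of approximate SVP on ideal lattices, and the shape
of the Lyubashevsky–Peikert–Regev main theorem "Ideal-SVP quantum-hard ⇒ decision Ring-LWE
pseudorandom" (the security basis of ML-KEM / FIPS 203).

## Contents

* Bit-string interfaces (§ Encodings): coordinates `rqCoords` of `R_q = 𝓞 K ⧸ (q)` in a given
  `ℤ`-basis of `𝓞 K` (a genuine quotient lift, `Submodule.liftQ`), encoders `rqEncode`,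
  `encodeSamples` of Ring-LWE and Module-LWE sample tuples, and the induced distinguishers / SVP success
  probabilities `UniformQCircuitFamily.moduleLWEDistinguisher`,
  `UniformQCircuitFamily.svpSuccessProb` of a quantum family.
* Statements (§ Statements): `RingLWEDecisionAssumption`, `cyclotomicRingLWEAssumption`,
  `ModuleLWEDecisionAssumption`, `IdealSVPQuantumHardness`, `LPRMainTheoremStatement`
  (all **pqc.S29**).

## Quantum model (reused, not redefined)

The planned trunk G11 (`QuantumCircuit`, `ClassBQP`) is not available.  This file does NOT
introduce its own quantum glue: it reuses the PROVISIONAL model of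
`Literature.Statements.PQC.LWEHardness` — `Literature.PQC.QCircuit` over `{H, T, CNOT}` with Born-rule kernel
`QCircuit.kernel : List Bool → PMF (List Bool)`, and `Literature.Computability.Cryptography.UniformQCircuitFamily` (circuits
`C n` indexed by input length, `1ⁿ ↦ ⟨C n⟩` polynomial-time computable via G01's
`PolyTimeComputable`) with `UniformQCircuitFamily.kernel x = (C |x|).kernel x` and the acceptance
convention `Literature.Computability.Cryptography.Accepts` (first measured bit `1`).  Inputs to the adversary carry a unary
prefix `1^{n_k}` (the degree), so "polynomial time in the input length" is polynomial time in the
degree, as in LPR 2013.  Once G11 lands, `UniformQCircuitFamily` is to be replaced by G11's uniform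
quantum polynomial-time families and the statements below restated verbatim.

## Mathlib / H21 anchors

Mathlib: `Submodule.liftQ`, `Submodule.Quotient.restrictScalarsEquiv` (the `ℤ`-linear
coordinate map on `𝓞 K ⧸ (q)`; Mathlib's `Ideal.quotientEquivPiZMod` uses a Smith normal form
basis, not a prescribed one, hence is not used), `CyclotomicField`,
`IsCyclotomicExtension.zeta_spec`, `IsPrimitiveRoot.integralPowerBasis` (power basis of
`𝓞 (CyclotomicField (2^k) ℚ)`), `Filter.atTop`, `PMF.map`, `PMF.toOuterMeasure`.  Mathlib has no
quantum circuits, no BQP, no LWE (searched `qubit`, `BQP`, `LWE`).  The negligible-function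
idiom `∀ c, ∀ᶠ k, adv ≤ 1/n_k^c` is `Asymptotics.SuperpolynomialDecay`
(`Mathlib/Analysis/Asymptotics/SuperpolynomialDecay.lean`) in disguise; it is kept explicit as in
`Literature.Statements.PQC.LWE`/`LWEHardness` and is to be restated through T-CRYPTO's `Negligible`
once G11 ships it.
H21: `Literature.Computability.Cryptography.RingLWE.Rq`, `gaussianError`, `distinguishingAdvantage`, `moduleLWESample`,
`IsIdealLatticeInstance`; `Literature.Algebra.EuclideanLattices.SVP.IsSolution`, `LatticeInstance.encode`, `decodeIntVec`;
`Literature.Computability.Complexity.boolPair`, `encodingFinVec`; `Literature.Computability.Cryptography.UniformQCircuitFamily`, `Accepts`.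

## Design choices (read with OUTLINE D6)

1. **Security parameter = degree.**  The families are indexed by `k : ℕ`, but all thresholds
   are powers of the degree `n_k = [K_k : ℚ]` (LPR 2013: everything is `poly(n)`), because for
   the cyclotomic instance `n_k = 2^{k-1}` is exponential in `k`.  Every threshold sits under
   `∀ᶠ k in atTop` (vacuity audit: `1/(0:ℝ)^c = 0`).  For a family of BOUNDED degree the
   thresholds `1/n_k^c` do not tend to `0` and the assumptions are weak/degenerate; the intended
   instance is the cyclotomic one (`cyclotomicRingLWEAssumption`), where `n_k → ∞`.
2. **Encodings are basis-dependent.**  A quantum adversary reads elements of `R_q` as coordinate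
   vectors in a prescribed `ℤ`-basis `b_k` of `𝓞 K_k`; the assumptions therefore take the basis
   family as an argument (for cyclotomics: Mathlib's integral power basis `1, ζ, …, ζ^{n-1}`,
   the encoding of LPR 2013 / FIPS 203).
3. **Error model (D6).**  Errors are `Literature.Computability.Cryptography.RingLWE.gaussianError`: the discretised, non-dual,
   spherical Gaussian on `σ(𝓞 K)` in Mathlib's Euclidean mixed space (norm `‖·‖_can/√2` on complex
   places), reduced mod `q`.  LPR 2013 use continuous (elliptical, for decision) Gaussians on
   `K_ℝ` and secrets in `R^∨_q`.  Hence `LPRMainTheoremStatement` is a `def`, NOT a theorem.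
4. **Hardness in the eventually/infinitely-often robust form.**  `IdealSVPQuantumHardness` says
   that every quantum family fails, for all large `k`, on some ideal-lattice instance of `K_k`;
   its negation is an infinitely-often solver — the quantifier SHAPE of what LPR's reduction
   produces from an infinitely-often distinguisher; but LPR's solver is a `K-SVP` solver handed
   the ideal itself (Def. 2.10), not a bare-instance solver (audit (M1), `LPRMainTheoremStatement`).
5. Ideal-lattice instances are the *integer* lattice instances of `Literature.Lattice` that are
   isometric to some `σ(𝔞)` (`Literature.Computability.Cryptography.RingLWE.IsIdealLatticeInstance`); for power-of-two
   cyclotomics `σ(𝓞 K)` is `√(n/2)`-times a rotated `ℤⁿ` lattice, so such instances abound, but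
   for fields whose ideal lattices are not similar to integer lattices (e.g. `ℚ(ζ₃)`) the instance
   set is empty and the hardness predicate degenerates to `False`; for other fields the instance
   set is a sub-class of all ideal lattices, making the hardness hypothesis *stronger* than LPR's
   (by itself the safe direction) — but the instances are *bare* integer bases with the ideal
   structure hidden, which works in the opposite (unsafe) direction: audit (M1) in the docstring
   of `LPRMainTheoremStatement`.  Prelude-level debt (a rational/scaled instance notion and an
   explicit-ideal presentation would fix it), recorded here.

## References

* V. Lyubashevsky, C. Peikert, O. Regev, *On ideal lattices and learning with errors over
  rings*, J. ACM 60 (2013), Art. 43, Thm 3.6 (main theorem), §3.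
* A. Langlois, D. Stehlé, *Worst-case to average-case reductions for module lattices*, Des. Codes
  Cryptogr. 75 (2015), §1, §3, Thm 4.7 area.
* C. Peikert, *A decade of lattice cryptography* (2016), §4.3–4.4.
* S. Arora, B. Barak, *Computational Complexity: A Modern Approach* (2009), §0.1, Def. 10.9.
* NIST FIPS 203 (2024), ML-KEM (Module-LWE over `ℤ_q[X]/(X^256+1)`).
-/

noncomputable section

open scoped ENNReal nonZeroDivisors NumberField
open Filter NumberField

namespace Literature.Computability.Cryptography

section PQC

/-! ### Bit-string interfaces for `R_q`, LWE samples and SVP -/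

section Encodings

open Complexity _root_.Computability

variable {K : Type} [Field K] {n : ℕ} (b : Module.Basis (Fin n) ℤ (𝓞 K)) (q : ℕ)

/-- The `ℤ`-linear map `𝓞 K → (ℤ/qℤ)ⁿ`, `y ↦ (b-coordinates of y) mod q`
(Lyubashevsky–Peikert–Regev 2013, §2.3 "coefficient embedding"). [cite: LyubashevskyPeikertRegev2013, §2.3 "coefficient embedding"] -/
def intCoordsMod : 𝓞 K →ₗ[ℤ] (Fin n → ZMod q) :=
  (LinearMap.compLeft (Int.castRingHom (ZMod q)).toIntLinearMap (Fin n)).comp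
    ((Finsupp.linearEquivFunOnFinite ℤ ℤ (Fin n)).toLinearMap.comp b.repr.toLinearMap)

/-- `intCoordsMod b q y i = (b.repr y i) mod q`. [folklore] -/
@[simp]
theorem intCoordsMod_apply (y : 𝓞 K) (i : Fin n) :
    intCoordsMod b q y i = ((b.repr y i : ℤ) : ZMod q) :=
  rfl

/-- The ideal `(q)` is killed by `intCoordsMod`: the coordinates of `q · z` are `q`-multiples. [folklore] -/
theorem span_le_ker_intCoordsMod :
    (Ideal.span {(q : 𝓞 K)}).restrictScalars ℤ ≤ LinearMap.ker (intCoordsMod b q) := by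
  intro x hx
  rw [Submodule.restrictScalars_mem, Ideal.mem_span_singleton'] at hx
  obtain ⟨a, rfl⟩ := hx
  rw [LinearMap.mem_ker]
  ext i
  rw [intCoordsMod_apply, ← Nat.cast_comm, ← nsmul_eq_mul, map_nsmul, Finsupp.smul_apply,
    nsmul_eq_mul, Int.cast_mul, Int.cast_natCast, ZMod.natCast_self, zero_mul, Pi.zero_apply]

/-- Coordinates of `x ∈ R_q = 𝓞 K ⧸ (q)` in the `ℤ`-basis `b` of `𝓞 K`, reduced mod `q`: the
`ℤ`-linear isomorphism `R_q ≅ (ℤ/qℤ)ⁿ` induced by `b`, defined as the quotient lift of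
`intCoordsMod` (`Submodule.liftQ` along `Submodule.Quotient.restrictScalarsEquiv`; no choice of
representatives).  (Lyubashevsky–Peikert–Regev 2013, §2.3; FIPS 203, §4.2.1 for the power basis.)
Mathlib's `Ideal.quotientEquivPiZMod` is the analogous isomorphism in a Smith normal form basis,
not in a prescribed basis, hence not used.  Named `rqCoords` (not `Rq.coords`) since
`Literature.Computability.Cryptography.RingLWE.Rq` is an `abbrev` for a quotient and affords no dot-notation. [cite: LyubashevskyPeikertRegev2013, §2.3] -/
def rqCoords : RingLWE.Rq K q →ₗ[ℤ] (Fin n → ZMod q) :=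
  (((Ideal.span {(q : 𝓞 K)}).restrictScalars ℤ).liftQ (intCoordsMod b q)
      (span_le_ker_intCoordsMod b q)).comp
    (Submodule.Quotient.restrictScalarsEquiv ℤ (Ideal.span {(q : 𝓞 K)})).symm.toLinearMap

/-- `rqCoords (y mod q) = (b-coordinates of y) mod q`, by `rfl`. [folklore] -/
@[simp]
theorem rqCoords_mk (y : 𝓞 K) :
    rqCoords b q (Ideal.Quotient.mk _ y) = fun i => ((b.repr y i : ℤ) : ZMod q) :=
  rfl

/-- The coordinate map `R_q → (ℤ/qℤ)ⁿ` is injective: if all `b`-coordinates of `y - y'` are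
divisible by `q` then `y - y' ∈ (q)`. [folklore] -/
theorem rqCoords_injective : Function.Injective (rqCoords b q) := by
  rw [← LinearMap.ker_eq_bot, Submodule.eq_bot_iff]
  intro x hx
  induction x using Submodule.Quotient.induction_on with
  | H y =>
    rw [LinearMap.mem_ker] at hx
    change (fun i => ((b.repr y i : ℤ) : ZMod q)) = 0 at hx
    rw [Submodule.Quotient.mk_eq_zero, Ideal.mem_span_singleton']
    have hdvd : ∀ i, (q : ℤ) ∣ b.repr y i := fun i =>
      (ZMod.intCast_zmod_eq_zero_iff_dvd _ q).1 (congrFun hx i)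
    choose c hc using hdvd
    refine ⟨b.repr.symm (Finsupp.equivFunOnFinite.symm c), ?_⟩
    apply b.repr.injective
    ext i
    rw [← Nat.cast_comm, ← nsmul_eq_mul, map_nsmul, Finsupp.smul_apply,
      LinearEquiv.apply_symm_apply, Finsupp.coe_equivFunOnFinite_symm, hc i, nsmul_eq_mul]

/-- Bit string of `x ∈ R_q`: its coordinate vector in the basis `b`, entries the canonical
representatives in `[0, q)`, in G01's `encodingFinVec encodingNatBool` format
(Arora–Barak 2009, §0.1). [cite: AroraBarak2009, §0.1] -/
def rqEncode (x : RingLWE.Rq K q) : List Bool :=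
  (encodingFinVec encodingNatBool n).encode fun i => (rqCoords b q x i).val

/-- `rqEncode` is injective (`rqCoords_injective`, `ZMod.val_injective` and injectivity of G01
encodings). [folklore] -/
theorem rqEncode_injective [NeZero q] : Function.Injective (rqEncode b q) := by
  intro x y h
  apply rqCoords_injective b q
  have h' := (encodingFinVec encodingNatBool n).encode_injective h
  funext i
  exact ZMod.val_injective q (congrFun h' i)

/-- Bit string of a tuple of `m` Module-LWE (for `d = 1`: Ring-LWE) samples
`(aᵢ, bᵢ) ∈ R_q^d × R_q`: every entry of `R_q` is written as its vector of `b`-coordinate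
representatives in `[0, q)`, and the tuple is coded by G01's `encodingFinVec`/`pairBool`
combinators over Mathlib's `encodingNatBool`, exactly as `Literature.Computability.Cryptography.encodeLWESamples`
(Arora–Barak 2009, §0.1; Langlois–Stehlé 2015, §3 for the input format `(R_q^d × R_q)^m`). [cite: AroraBarak2009, §0.1] -/
def encodeSamples {d m : ℕ} (v : Fin m → (Fin d → RingLWE.Rq K q) × RingLWE.Rq K q) :
    List Bool :=
  (encodingFinVec (((encodingFinVec (encodingFinVec encodingNatBool n) d)).pairBool
      (encodingFinVec encodingNatBool n)) m).encode
    fun i => (fun j l => (rqCoords b q ((v i).1 j) l).val, fun l => (rqCoords b q (v i).2 l).val)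

/-- The decision-LWE distinguisher over `R_q` (rank `d`, `m` samples) computed by the uniform
quantum circuit family `Q` (deliberate dot-notation extension of
`Literature.Computability.Cryptography.UniformQCircuitFamily`): feed `boolPair 1^{secParam} (encodeSamples b q v)` to `Q` and
accept iff the first measured bit is `1` (`Literature.Computability.Cryptography.Accepts`).  (Lyubashevsky–Peikert–Regev 2013,
§3, decision R-LWE adversaries; Langlois–Stehlé 2015, §3; Arora–Barak 2009, Def. 10.9.) [cite: LyubashevskyPeikertRegev2013, §3  decision R-LWE adversaries] -/
def UniformQCircuitFamily.moduleLWEDistinguisher (Q : UniformQCircuitFamily) (secParam d m : ℕ) :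
    LWE.Distinguisher (Fin d) (RingLWE.Rq K q) m :=
  fun v => (Q.kernel (boolPair (unaryEncodeNat secParam) (encodeSamples b q v))).map
    fun w => decide (Accepts w)

/-- The probability that the uniform quantum circuit family `Q`, given the code of the integer
lattice instance `I`, outputs (the code of) a solution of `SVP_γ` on `I` (output register decoded
by `Literature.Lattice.decodeIntVec I.n`; deliberate dot-notation extension of
`Literature.Computability.Cryptography.UniformQCircuitFamily`).  (Micciancio–Goldwasser 2002, Ch. 1, §1.2; Peikert 2016,
Def. 2.2.1.) [cite: MicciancioGoldwasser2002, Ch. 1  §1.2] -/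
def UniformQCircuitFamily.svpSuccessProb (Q : UniformQCircuitFamily) (γ : ℕ → ℝ)
    (I : Literature.Algebra.EuclideanLattices.LatticeInstance) : ℝ≥0∞ :=
  ((Q.kernel I.encode).map (Literature.Algebra.EuclideanLattices.decodeIntVec I.n)).toOuterMeasure
    {v | Literature.Algebra.EuclideanLattices.SVP.IsSolution γ I v}

/-- A success probability is at most `1`. [folklore] -/
theorem UniformQCircuitFamily.svpSuccessProb_le_one (Q : UniformQCircuitFamily) (γ : ℕ → ℝ)
    (I : Literature.Algebra.EuclideanLattices.LatticeInstance) : Q.svpSuccessProb γ I ≤ 1 :=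
  (PMF.toOuterMeasure_mono _ (Set.subset_univ _)).trans_eq
    ((PMF.toOuterMeasure_apply_eq_one_iff _ _).2 (Set.subset_univ _))

end Encodings

/-! ### Statements (**pqc.S29**) -/

section Statements

variable (K : ℕ → Type) [∀ k, Field (K k)] [∀ k, NumberField (K k)] {n : ℕ → ℕ}
  (b : ∀ k, Module.Basis (Fin (n k)) ℤ (𝓞 (K k)))

/-- **pqc.S29** (decision Ring-LWE assumption, flag; Lyubashevsky–Peikert–Regev 2013, §3;
Peikert 2016, Def. 4.4.2; basis of ML-KEM / FIPS 203).  For the family of number fields `K k`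
with `ℤ`-bases `b k` of `𝓞 (K k)` (of rank `n k = [K k : ℚ]`), moduli `q k`, Gaussian parameters
`s k` and sample counts `m k`: *every* polynomial-time uniform quantum circuit family `Q`
(`Literature.Computability.Cryptography.UniformQCircuitFamily`, provisional for G11's quantum polynomial-time families) has
negligible advantage in distinguishing `m k` normal-form Ring-LWE samples `(a, a s + e)`,
`e ← gaussianError (K k) (q k) (s k)`, `s ← U(R_q)`, from uniform: for every `c`, eventually in
`k`, `adv ≤ 1/(n k)^c`.  Security parameter = degree `n k` (design note 1; for bounded-degree
families the thresholds do not tend to `0` and the assumption is degenerate — the intended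
instance is `cyclotomicRingLWEAssumption`); thresholds under `∀ᶠ k in atTop` (vacuity audit);
the `∀ c, ∀ᶠ` idiom is T-CRYPTO's `Negligible` (`Asymptotics.SuperpolynomialDecay`), to be
substituted once G11 ships it.  Error model: the discretised non-dual spherical Gaussian of
OUTLINE D6 (norm `‖·‖_can/√2` on complex places). [cite: LyubashevskyPeikertRegev2013, §3] -/
def RingLWEDecisionAssumption (q : ℕ → ℕ) [∀ k, NeZero (q k)] (s : ℕ → ℝ) (m : ℕ → ℕ) : Prop :=
  ∀ Q : UniformQCircuitFamily, ∀ c : ℕ, ∀ᶠ k in atTop,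
    RingLWE.distinguishingAdvantage (RingLWE.gaussianError (K k) (q k) (s k)) (m k)
      (Q.moduleLWEDistinguisher (b k) (q k) (n k) 1 (m k)) ≤ 1 / (n k : ℝ) ^ c

/-- **pqc.S29** (decision Module-LWE assumption of rank `d k`, flag; Langlois–Stehlé 2015, §1
and §3; FIPS 203 uses `d ∈ {2, 3, 4}` over `ℤ_q[X]/(X^256 + 1)`).  As
`RingLWEDecisionAssumption`, with samples `(a, ⟨a, s⟩ + e)`, `a ← U(R_q^{d k})`
(`Literature.RingLWE.moduleLWESample (d k)`, i.e. generic LWE over `R = R_q`, `ι = Fin (d k)`). [cite: LangloisStehle2015, §1 and §3] -/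
def ModuleLWEDecisionAssumption (d : ℕ → ℕ) (q : ℕ → ℕ) [∀ k, NeZero (q k)] (s : ℕ → ℝ)
    (m : ℕ → ℕ) : Prop :=
  ∀ Q : UniformQCircuitFamily, ∀ c : ℕ, ∀ᶠ k in atTop,
    LWE.distinguishingAdvantage (RingLWE.gaussianError (K k) (q k) (s k)) (m k)
      (Q.moduleLWEDistinguisher (b k) (q k) (n k) (d k) (m k)) ≤ 1 / (n k : ℝ) ^ c

/-- Module-LWE of rank `1` *is* Ring-LWE (definitionally: `Literature.Computability.Cryptography.RingLWE.distinguishingAdvantage`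
is the generic LWE advantage at `ι = Fin 1`; Langlois–Stehlé 2015, §1). [cite: LangloisStehle2015, §1] -/
theorem moduleLWEDecisionAssumption_one_iff (q : ℕ → ℕ) [∀ k, NeZero (q k)] (s : ℕ → ℝ)
    (m : ℕ → ℕ) :
    ModuleLWEDecisionAssumption K b (fun _ => 1) q s m ↔ RingLWEDecisionAssumption K b q s m :=
  Iff.rfl

/-- **pqc.S29** (quantum worst-case hardness of `SVP_γ` on ideal lattices, flag;
Lyubashevsky–Peikert–Regev 2013, §2.3.5 and Thm 3.6 hypothesis; Peikert 2016, §4.3.4).  For every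
polynomial-time uniform quantum circuit family `Q`, for all sufficiently large `k` there is an
integer lattice instance `I` which is (isometric to) an ideal lattice `σ(𝔞)` of `K k`
(`RingLWE.IsIdealLatticeInstance`, through Mathlib's `mixedEmbedding.idealLattice` pulled back to
the Euclidean mixed space) on which `Q` outputs an `SVP_γ` solution with probability `< 2/3`;
equivalently, no such family solves it in dimension `[K k : ℚ]` for infinitely many `k` (design
note 4: the quantifier shape whose negation LPR's reduction produces).  Norms are those of
Mathlib's Euclidean mixed space, i.e. `‖·‖_can/√2` on complex places for totally complex `K` (an
approximation factor is insensitive to this rescaling; `GapSVP` thresholds would not be).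
Caveats (design note 5, prelude debt): for fields whose ideal lattices are not similar to integer
lattices the instance set is empty and this predicate is `False`; in general the instance set is a
sub-class of all ideal lattices (by itself the safe, stronger direction) — BUT the instances are
bare integer bases whose ideal structure is hidden behind `∃ 𝔞 ∃ isometry`, whereas LPR's
`K-SVP_γ` (Def. 2.10, p. 15) hands the solver the ideal; a bare-instance solver yields a `K-SVP`
solver (the forgetful map is computable), so this hypothesis is WEAKER than LPR's and consuming
`(h : IdealSVPQuantumHardness …)` in place of LPR's hypothesis is the UNSAFE direction (audit (M1)
in the docstring of `LPRMainTheoremStatement`). [cite: LyubashevskyPeikertRegev2013, §2.3.5 and Def. 2.10] -/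
def IdealSVPQuantumHardness (γ : ℕ → ℝ) : Prop :=
  ∀ Q : UniformQCircuitFamily, ∀ᶠ k in atTop, ∃ I : Literature.Algebra.EuclideanLattices.LatticeInstance,
    RingLWE.IsIdealLatticeInstance (K k) I ∧ Q.svpSuccessProb γ I < 2 / 3

variable {K b} in
/-- Monotonicity: hardness of `SVP_{γ'}` implies hardness of `SVP_γ` for `γ ≤ γ'` (a `γ`-solution
is a `γ'`-solution, `Literature.Algebra.EuclideanLattices.SVP.isSolution_mono`). [folklore] -/
theorem IdealSVPQuantumHardness.anti {γ γ' : ℕ → ℝ} (hγ : γ ≤ γ')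
    (h : IdealSVPQuantumHardness K γ') : IdealSVPQuantumHardness K γ := by
  intro Q
  filter_upwards [h Q] with k hk
  obtain ⟨I, hI, hlt⟩ := hk
  refine ⟨I, hI, lt_of_le_of_lt ?_ hlt⟩
  exact PMF.toOuterMeasure_mono _ fun v hv => Literature.Algebra.EuclideanLattices.SVP.isSolution_mono hγ hv.1

/-! #### The power-of-two cyclotomic instance -/

-- Same workaround as Mathlib's `IsCyclotomicExtension.Rat.cyclotomicRing_isIntegralClosure`: the
-- instance `IsCyclotomicExtension {n} ℚ (CyclotomicField n ℚ)` is keyed on `CyclotomicField.algebra`,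
-- the goal on `DivisionRing.toRatAlgebra` (defeq, but not at instance transparency).
set_option backward.isDefEq.respectTransparency false in
/-- The integral power basis `1, ζ, …, ζ^{φ(2^k) - 1}` of `𝓞 (ℚ(ζ_{2^k})) = ℤ[ζ_{2^k}]`
(Mathlib's `IsPrimitiveRoot.integralPowerBasis` at `IsCyclotomicExtension.zeta`); this is the
coefficient encoding `ℤ[X]/(X^{2^{k-1}} + 1)` of LPR 2013 (§2.3.4, Example 2.8: `𝓞_K = ℤ[ζ_m]`) and FIPS 203. [cite: LyubashevskyPeikertRegev2013, §2.3.4 Example 2.8] -/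
def cyclotomicPowerBasis (k : ℕ) : PowerBasis ℤ (𝓞 (CyclotomicField (2 ^ k) ℚ)) :=
  (IsCyclotomicExtension.zeta_spec (2 ^ k) ℚ (CyclotomicField (2 ^ k) ℚ)).integralPowerBasis

set_option backward.isDefEq.respectTransparency false in -- see `cyclotomicPowerBasis`
/-- The power basis of `ℤ[ζ_{2^k}]` has `φ(2^k)` elements (Mathlib
`IsPrimitiveRoot.integralPowerBasis_dim`). [folklore] -/
theorem cyclotomicPowerBasis_dim (k : ℕ) : (cyclotomicPowerBasis k).dim = Nat.totient (2 ^ k) :=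
  IsPrimitiveRoot.integralPowerBasis_dim _

/-- For `k ≥ 1`, `φ(2^k) = 2^{k-1}`: the degree of `ℚ(ζ_{2^k})` (Washington, *Cyclotomic
fields*, Ch. 2; Mathlib `Nat.totient_prime_pow`). [folklore] -/
theorem cyclotomicPowerBasis_dim_of_pos {k : ℕ} (hk : 0 < k) :
    (cyclotomicPowerBasis k).dim = 2 ^ (k - 1) := by
  rw [cyclotomicPowerBasis_dim, Nat.totient_prime_pow Nat.prime_two hk]
  simp

/-- **pqc.S29** (decision Ring-LWE over power-of-two cyclotomics, flag; Lyubashevsky–Peikert–Regev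
2013, §3; FIPS 203 with `n = 256`).  `RingLWEDecisionAssumption` for `K k = ℚ(ζ_{2^k})`
(`CyclotomicField (2 ^ k) ℚ`, degree `n k = φ(2^k) = 2^{k-1}` for `k ≥ 1`), elements of
`R_q = ℤ_q[X]/(X^{2^{k-1}} + 1)` encoded by their coefficients in the power basis. [folklore] -/
def cyclotomicRingLWEAssumption (q : ℕ → ℕ) [∀ k, NeZero (q k)] (s : ℕ → ℝ) (m : ℕ → ℕ) :
    Prop :=
  RingLWEDecisionAssumption (fun k => CyclotomicField (2 ^ k) ℚ)
    (fun k => (cyclotomicPowerBasis k).basis) q s m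

/-- **pqc.S29** (shape of the Lyubashevsky–Peikert–Regev main theorem, J. ACM 60 (2013) Art. 43,
Thm 3.6, RECORDED AS A STATEMENT — a `def … : Prop`, deliberately NOT asserted as a `theorem`, and
— audit 2026-08-15 below — NOT a faithful transcription of the printed theorem either).  For the
power-of-two cyclotomic family `K k = ℚ(ζ_{2^k})` of degree `n = 2^{k-1}`: let `q k` be primes
with `q k ≡ 1 (mod 2^k)` (eventually) and `q ≤ poly(n)`, sample counts `m ≤ poly(n)`, and
`0 < α k < √(log n / n)` with `α q ≥ ω(√(log n))` (`α q / √(log n) → ∞`).  Then for some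
approximation factor `γ = Õ(√n / α)` (`γ n ≤ C (√n/α) (log n)^e` eventually), quantum hardness of
`SVP_γ` on ideal lattices of `K k` (bare presentation `IdealSVPQuantumHardness`) implies the
decision Ring-LWE assumption with the spherical error parameter `s k = n · α k · q k / √2`.
On the hypotheses: (i) `α < √(log n / n)` is NOT a hypothesis of Thm 3.6 in the journal/full
version (which has `α = α(n) > 0`); it is the non-triviality regime of §3.1 (p. 19: errors must
stay below `ω(√log n)/√n`, the smoothing bound of `R^∨`) and, as an extra hypothesis, only
weakens the recorded proposition; (ii) "`q`, `m` polynomially bounded" is polynomial *in the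
degree* `n k = 2^{k-1}`, not in the index `k`, hence written inline as
`∃ p : Polynomial ℕ, ∀ k, q k ≤ p.eval (n k)` and NOT as `LWE.IsPolyBounded` (index-bounded).

Audit against the source (2026-08-15; Thm 3.6, p. 20: "a polynomial-time quantum reduction from
`Õ(√n/α)`-approximate SIVP (or SVP) to `R-DLWE_{q,Υ_α}`.  Alternatively, for any `ℓ ≥ 1`, … solving
`R-DLWE_{q,D_ξ}` given only `ℓ` samples, where `ξ = α·(nℓ/log(nℓ))^{1/4}`").  Two substantive gaps:
(M1) LPR's worst-case problem `K-SVP_γ` (Def. 2.10) hands the solver the ideal itself; here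
`IdealSVPQuantumHardness` quantifies over bare integer bases isometric to some `σ(𝔞)` by an
unspecified isometry, hiding the ring structure the reduction uses — a WEAKER hypothesis (the
forgetful map is computable), so this implication is STRONGER than Thm 3.6 (design notes 4–5
amended accordingly).  (M2) `s = nαq/√2` is the rate-`α` SPHERICAL error with `poly(n)` samples;
Thm 3.6 prints only the randomised elliptical `Υ_α` (Def. 3.5) or the spherical `D_ξ`,
`ξ = α(nℓ/log(nℓ))^{1/4}`, for `ℓ` samples — the rate-`α` spherical unbounded-sample case is "not
implied by our worst-case hardness proof" (§1.2, p. 6).  Benign: (M3) the v0 error model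
(discretised, non-dual `RingLWE.gaussianError`; LPR: continuous Gaussians on `K_ℝ`, secrets in
`R^∨_q`) is covered for the `2^k`-th cyclotomics by the paper's own remarks (`R^∨ = n⁻¹R`, p. 19;
randomized rounding [GPV08, Pei10], p. 20) up to constants absorbed by the `ω(·)`/`Õ(·)`; the
normalisation `s = nαq/√2` = tweak by `n`, denominators cleared by `q`, `‖·‖ = ‖·‖_can/√2` on the
complex places of `euclidean.mixedSpace`.  A faithful transcription of the printed second form
needs the explicit presentation of the worst-case instances (for this `K`: anti-cyclic sublattices
of `ℤⁿ`, §1.1 p. 3) and the error width `ξ` for `ℓ = m k` samples; it is not in the tree.  Junk: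
`n = 2^{k-1}` by `ℕ`-subtraction (`n = 1` at `k = 0`, harmless under `∀ᶠ`). [cite: LyubashevskyPeikertRegev2013, Thm 3.6] -/
def LPRMainTheoremStatement : Prop :=
  ∀ (q : ℕ → ℕ) (α : ℕ → ℝ) (m : ℕ → ℕ) (hq : ∀ k, (q k).Prime),
    haveI : ∀ k, NeZero (q k) := fun k => ⟨(hq k).ne_zero⟩
    let n : ℕ → ℕ := fun k => 2 ^ (k - 1)
    (∀ᶠ k in atTop, q k ≡ 1 [MOD 2 ^ k]) →
    (∃ p : Polynomial ℕ, ∀ k, q k ≤ p.eval (n k)) →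
    (∃ p : Polynomial ℕ, ∀ k, m k ≤ p.eval (n k)) →
    (∀ᶠ k in atTop, 0 < α k ∧ α k < Real.sqrt (Real.log (n k) / n k)) →
    Tendsto (fun k => α k * q k / Real.sqrt (Real.log (n k))) atTop atTop →
    ∃ γ : ℕ → ℝ,
      (∃ C e : ℝ, ∀ᶠ k in atTop, γ (n k) ≤ C * (Real.sqrt (n k) / α k) * Real.log (n k) ^ e) ∧
      (IdealSVPQuantumHardness (fun k => CyclotomicField (2 ^ k) ℚ) γ →
        cyclotomicRingLWEAssumption q (fun k => n k * α k * q k / Real.sqrt 2) m)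

end Statements

end PQC

end Literature.Computability.Cryptography

end
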